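import Literature.Analysis.OperatorTheory.HilbertSchmidtOrthogonalSum
import Literature.NumberTheory.Automorphic.HilbertRepOrthogonalDecomposition
import Literature.NumberTheory.Automorphic.IntegratedOperator
import HarnessLib

/-!
# The Hilbert–Schmidt sum of `π(f)` along an orthogonal decomposition: blocks and their
# invariance under unitary equivalence of subrepresentations
(Gelbart, *Automorphic forms on adele groups* (1975), Lemma 10.6, (10.12)–(10.14); Reed–Simon I,
Thm. VI.22)

Topic `NumberTheory/Automorphic`; theorems only (no definition, no named fact, no instance). For a
unitary, strongly continuous representation `π` of `G` on a complex Hilbert space `H`, a measure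
`η` on `G` finite on compact sets and `f ∈ C_c(G)`, with `π(f) = ∫ f(g) π(g) dη(g)`
(`ContRepresentation.integratedOperator`, `IntegratedOperator`):

* `ClosedSubrep.tsum_enorm_sq_apply_eq_tsum_set` — for a set `S` of pairwise orthogonal closed
  subrepresentations with closed span `H`, Hilbert bases `(e^W_k)_k` of the `W ∈ S` and *any*
  Hilbert basis `(e_l)` of `H`, and any bounded `T`:
  `Σ_l ‖T e_l‖² = Σ_{W ∈ S} Σ_k ‖T e^W_k‖²`
  (`Literature.Analysis.OperatorTheory.tsum_enorm_sq_apply_eq_tsum_sigma`); for `T = π(f)`, which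
  preserves each `W`, the inner sum is the Hilbert–Schmidt sum of the block `π(f)|_W = (π|_W)(f)`.
* `ClosedSubrep.map_integratedOperator_eq` — **integrated operators commute with intertwiners of
  subrepresentations**: for an equivalence `e : W ≃ W'` of closed subrepresentations,
  `e (π(f) w) = π(f) (e w)` (`w ∈ W`): the operator `ι_{W'} ∘ e ∘ P_W` of `H` commutes with every
  `π(g)`, hence with the Bochner integral `π(f)`.
* `ClosedSubrep.tsum_enorm_sq_integratedOperator_eq_of_areUnitarilyEquivalent` — **the
  Hilbert–Schmidt sum of the block `π(f)|_W` depends only on the unitary equivalence class of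
  `W`**: if `W ≃ W'` unitarily then `Σ_k ‖π(f) e^W_k‖² = Σ_k ‖π(f) e^{W'}_k‖²` for all Hilbert bases
  of `W`, `W'` (transport the basis along the unitary `e`, basis independence
  `tsum_enorm_sq_apply_eq_of_hilbertBasis`, and the previous item).

* `IsUnitary.multiplicity_mul_tsum_enorm_sq_le`,
  `IsUnitary.multiplicity_mul_tsum_enorm_sq_le_of_isTopIrreducible` — **the multiplicity bound on
  the spectral side**: for an orthogonal decomposition `S` into irreducibles and every irreducible
  closed subrepresentation `V` (member of `S` or not),
  `multiplicity π V · Σ_k ‖π(f) e^V_k‖² ≤ Σ_l ‖π(f) e_l‖²` in `ℝ≥0∞` — with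
  `IsUnitary.multiplicity_eq_card` (`HilbertRepOrthogonalDecomposition`: the number of `W ∈ S` in
  the class of `V` is `multiplicity π V`) and the two previous items. This is Gelbart's
  "`m(π') tr π'(f) π'(f)^*` is a term of `tr R'_ψ(f ⋆ f^*) = Σ m(π) tr π(f) π(f)^*`"
  ((10.12)/(10.14)), whose geometric expansion for `D^×` is `QuaternionUnitsTraceHS`.

* `IsUnitary.tsum_subtype_areUnitarilyEquivalent_tsum_enorm_sq_eq`,
  `ClosedSubrep.tsum_enorm_sq_apply_eq_tsum_fiberwise`, `IsUnitary.tsum_fiber_tsum_enorm_sq_eq` —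
  **the equality form**: regrouping the blocks by the fibres of a map `q` classifying unitary
  equivalence, `‖π(f)‖²_{HS} = Σ_c Σ_{W ∈ q⁻¹(c)} ‖π(f)|_W‖²_{HS}` and each fibre contributes
  `multiplicity π W₀ · ‖π(f)|_{W₀}‖²_{HS}` — Gelbart's `Σ_π m(π) tr π(f) π(f)^*`.

A brick of the inline (D-0026) decomposition of
`Literature.NumberTheory.Automorphic.multiplicity_one_quaternionUnits` /
`strong_multiplicity_one_quaternionUnits` (Gelbart Thm. 10.10, Thm. 10.5 (ii)). The comparison
lemma that consumes such Hilbert–Schmidt (in)equalities between two representations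
(Jacquet–Langlands Lemma 16.1.1 = Gelbart's Lemma 10.6) is `HilbertRepTraceComparison`, which
carries its own copy of Parseval / basis independence in the `(‖·‖₊ : ℝ≥0∞)` spelling
(`tsum_nnnorm_sq_apply_eq_tsum_nnnorm_sq_adjoint_apply`; here `‖·‖ₑ`, Mathlib `enorm_eq_nnnorm`).

## References

* S. Gelbart, *Automorphic forms on adele groups*, Ann. of Math. Studies 83 (1975), Lemma 10.6,
  (10.12)–(10.14), Thm. 10.10 [Gelbart1975].
* M. Reed, B. Simon, *Methods of Modern Mathematical Physics I* (1972, rev. 1980), Thm. VI.18 (c),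
  Thm. VI.22 [ReedSimon1972].
-/

noncomputable section

open scoped InnerProductSpace ENNReal
open MeasureTheory Filter Topology CompactlySupported
open Literature.Analysis.OperatorTheory

namespace ContRepresentation

section Blocks

variable {G H : Type*} [Group G]
  [NormedAddCommGroup H] [InnerProductSpace ℂ H] [CompleteSpace H] {π : ContRepresentation ℂ G H}

/-- **The Hilbert–Schmidt sum of a bounded operator splits over an orthogonal decomposition of
`H` into closed subrepresentations**: for a set `S` of pairwise orthogonal closed
subrepresentations with closed span `H`, Hilbert bases `(e^W_k)_k` of the members and any Hilbert
basis `(e_l)` of `H`, `Σ_l ‖T e_l‖² = Σ_{W ∈ S} Σ_k ‖T e^W_k‖²` in `ℝ≥0∞`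
(`tsum_enorm_sq_apply_eq_tsum_sigma` of `HilbertSchmidtOrthogonalSum` for the family
`W ↦ W.toSubmodule`, `W ∈ S`; Reed–Simon I, Thm. VI.22). [cite: ReedSimon1972, Thm. VI.22] -/
theorem ClosedSubrep.tsum_enorm_sq_apply_eq_tsum_set {S : Set (ClosedSubrep π)}
    (horth : S.Pairwise fun W W' => W.toSubmodule ⟂ W'.toSubmodule)
    (hdense : ClosedSubrep.iSupClosure S = ⊤)
    {κ : S → Type*} (b : ∀ W : S, HilbertBasis (κ W) ℂ (W : ClosedSubrep π).toSubmodule)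
    {ι₀ : Type*} (B₀ : HilbertBasis ι₀ ℂ H)
    {F : Type*} [NormedAddCommGroup F] [InnerProductSpace ℂ F] [CompleteSpace F] (T : H →L[ℂ] F) :
    ∑' l, ‖T (B₀ l)‖ₑ ^ 2 = ∑' W : S, ∑' k, ‖T (b W k)‖ₑ ^ 2 := by
  have hV : OrthogonalFamily ℂ (fun W : S => (W : ClosedSubrep π).toSubmodule)
      fun W => (W : ClosedSubrep π).toSubmodule.subtypeₗᵢ :=
    OrthogonalFamily.of_pairwise (ClosedSubrep.pairwise_subtype_isOrtho horth)
  exact tsum_enorm_sq_apply_eq_tsum_sigma hV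
    (ClosedSubrep.orthogonal_iSup_eq_bot_of_iSupClosure_eq_top hdense) b B₀ T

end Blocks

section Integrated

variable {G H : Type*} [Group G] [TopologicalSpace G] [MeasurableSpace G] [OpensMeasurableSpace G]
  [NormedAddCommGroup H] [InnerProductSpace ℂ H] [CompleteSpace H] {π : ContRepresentation ℂ G H}

/-- **Integrated operators commute with intertwiners of closed subrepresentations**: for unitary
strongly continuous `π`, an equivalence `e : W ≃ W'` of closed subrepresentations, `f ∈ C_c(G)`
and `w ∈ W`, `e (π(f) w) = π(f) (e w)` in `H`. The operator `U = ι_{W'} ∘ e ∘ P_W` of `H`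
commutes with every `π(g)` (`P_W` is equivariant for unitary `π`,
`ClosedSubrep.orthogonalProjectionOnto_map_apply`; `e` intertwines), hence with the Bochner
integral `π(f) v = ∫ f(g) • π(g) v` (Mathlib `ContinuousLinearMap.integral_comp_comm`), and
`U w = e w`, `U (π(f) w) = e (π(f) w)` because `π(f) w ∈ W` (`integratedOperator_apply_mem`).
[cite: Gelbart1975, Lemma 10.6] -/
theorem ClosedSubrep.map_integratedOperator_eq (hu : π.IsUnitary) (hc : π.IsStronglyContinuous)
    (η : Measure G) [IsFiniteMeasureOnCompacts η] (f : C_c(G, ℂ)) {W W' : ClosedSubrep π}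
    (e : W.toContRep.Equiv W'.toContRep) (w : W.toSubmodule) :
    ((e ⟨π.integratedOperator hu hc η f w,
        integratedOperator_apply_mem hu hc η f W w.2⟩ : W'.toSubmodule) : H) =
      π.integratedOperator hu hc η f (e w : W'.toSubmodule) := by
  -- the intertwiner `U = ι_{W'} ∘ e ∘ P_W` of `π`
  set U : H →L[ℂ] H := W'.toSubmodule.subtypeL ∘L
    ((e.toContinuousLinearEquiv : W.toSubmodule →L[ℂ] W'.toSubmodule) ∘L
      W.toSubmodule.orthogonalProjectionOnto) with hUdef
  have hUapply : ∀ x : H,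
      U x = ((e (W.toSubmodule.orthogonalProjectionOnto x) : W'.toSubmodule) : H) := fun x => rfl
  have hUmem : ∀ {x : H} (hx : x ∈ W), U x = ((e ⟨x, hx⟩ : W'.toSubmodule) : H) := by
    intro x hx
    rw [hUapply, Submodule.orthogonalProjectionOnto_mem_subspace_eq_self ⟨x, hx⟩]
  have hUg : ∀ (g : G) (x : H), U (π g x) = π g (U x) := by
    intro g x
    have hex : e (W.toContRep g (W.toSubmodule.orthogonalProjectionOnto x)) =
        W'.toContRep g (e (W.toSubmodule.orthogonalProjectionOnto x)) :=
      e.toContIntertwiningMap.isIntertwining g _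
    rw [hUapply, hUapply, W.orthogonalProjectionOnto_map_apply hu g x, hex,
      ClosedSubrep.coe_toContRep_apply]
  -- `U` commutes with the Bochner integral
  have hcomm : U (π.integratedOperator hu hc η f w) = π.integratedOperator hu hc η f (U w) := by
    rw [integratedOperator_apply, integratedOperator_apply,
      ← ContinuousLinearMap.integral_comp_comm U (integrable_smul_apply hc η f (w : H))]
    refine integral_congr_ae (Eventually.of_forall fun g => ?_)
    change U (f g • π g (w : H)) = f g • π g (U w)
    rw [map_smul, hUg]
  rw [hUmem (integratedOperator_apply_mem hu hc η f W w.2), hUmem w.2] at hcomm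
  simpa using hcomm

/-- **The Hilbert–Schmidt sum of the block `π(f)|_W` depends only on the unitary equivalence class
of `W`** (Gelbart (1975), Lemma 10.6 and (10.12): equivalent constituents contribute equal terms
`tr π^j(f) π^j(f)^*`; Reed–Simon I, Thm. VI.18 (c) / VI.22). If `W ≃ W'` unitarily then for all
Hilbert bases `(e_k)` of `W` and `(e'_j)` of `W'`, `Σ_j ‖π(f) e'_j‖² = Σ_k ‖π(f) e_k‖²`: transport
`(e_k)` along the unitary `W ≃ W'` to a Hilbert basis of `W'`
(`exists_hilbertBasis_map_linearIsometryEquiv`), use basis independence on `W'`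
(`tsum_enorm_sq_apply_eq_of_hilbertBasis`) and `map_integratedOperator_eq` with the isometry.
[cite: Gelbart1975, Lemma 10.6] [cite: ReedSimon1972, Thm. VI.22] -/
theorem ClosedSubrep.tsum_enorm_sq_integratedOperator_eq_of_areUnitarilyEquivalent
    (hu : π.IsUnitary) (hc : π.IsStronglyContinuous) (η : Measure G) [IsFiniteMeasureOnCompacts η]
    (f : C_c(G, ℂ)) {W W' : ClosedSubrep π}
    (he : AreUnitarilyEquivalent W.toContRep W'.toContRep)
    {ι ι' : Type*} (b : HilbertBasis ι ℂ W.toSubmodule) (b' : HilbertBasis ι' ℂ W'.toSubmodule) :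
    ∑' j, ‖π.integratedOperator hu hc η f (b' j)‖ₑ ^ 2 =
      ∑' k, ‖π.integratedOperator hu hc η f (b k)‖ₑ ^ 2 := by
  obtain ⟨e, heiso⟩ := he
  -- `e` as a unitary `W ≃ W'`
  let Ue : W.toSubmodule ≃ₗᵢ[ℂ] W'.toSubmodule :=
    { (e.toContinuousLinearEquiv : W.toSubmodule ≃L[ℂ] W'.toSubmodule).toLinearEquiv with
      norm_map' := fun v => heiso.norm_map_of_map_zero (map_zero e) v }
  have hUe : ∀ v, Ue v = e v := fun v => rfl
  obtain ⟨bU, hbU⟩ := exists_hilbertBasis_map_linearIsometryEquiv b Ue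
  -- the blocks as operators `W → H`, `W' → H`
  set T : W.toSubmodule →L[ℂ] H := π.integratedOperator hu hc η f ∘L W.toSubmodule.subtypeL
    with hT
  set T' : W'.toSubmodule →L[ℂ] H := π.integratedOperator hu hc η f ∘L W'.toSubmodule.subtypeL
    with hT'
  have hTapply : ∀ v : W.toSubmodule, T v = π.integratedOperator hu hc η f v := fun v => rfl
  have hT'apply : ∀ v : W'.toSubmodule, T' v = π.integratedOperator hu hc η f v := fun v => rfl
  calc ∑' j, ‖π.integratedOperator hu hc η f (b' j)‖ₑ ^ 2 = ∑' j, ‖T' (b' j)‖ₑ ^ 2 := by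
        simp_rw [hT'apply]
    _ = ∑' k, ‖T' (bU k)‖ₑ ^ 2 := tsum_enorm_sq_apply_eq_of_hilbertBasis b' bU T'
    _ = ∑' k, ‖π.integratedOperator hu hc η f (b k)‖ₑ ^ 2 := by
        refine tsum_congr fun k => ?_
        have hnorm : ‖((e ⟨π.integratedOperator hu hc η f (b k),
            integratedOperator_apply_mem hu hc η f W (b k).2⟩ : W'.toSubmodule) : H)‖ =
            ‖π.integratedOperator hu hc η f (b k)‖ := by
          rw [Submodule.norm_coe, heiso.norm_map_of_map_zero (map_zero e)]
          rfl
        rw [hT'apply, hbU k, hUe, ← ClosedSubrep.map_integratedOperator_eq hu hc η f e (b k),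
          ← ofReal_norm, hnorm, ofReal_norm]

/-! ### The multiplicity bound on the spectral side -/

/-- **`m(W₀) · ‖π(f)|_{W₀}‖²_{HS} ≤ ‖π(f)‖²_{HS}`** (the spectral side of Gelbart (1975), (10.12)–
(10.14), as an inequality): for unitary strongly continuous `π`, an orthogonal decomposition `S`
of `H` into irreducibles, a member `W₀ ∈ S`, Hilbert bases `(e^W_k)` of the members and any
Hilbert basis `(e_l)` of `H`,
`multiplicity π W₀ · Σ_k ‖π(f) e^{W₀}_k‖² ≤ Σ_l ‖π(f) e_l‖²` in `ℝ≥0∞`. Indeed the right-hand side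
is `Σ_{W ∈ S} Σ_k ‖π(f) e^W_k‖²` (`tsum_enorm_sq_apply_eq_tsum_set`), the members `W ≃ W₀`
contribute equal blocks (`tsum_enorm_sq_integratedOperator_eq_of_areUnitarilyEquivalent`), and
there are `multiplicity π W₀` of them (`IsUnitary.multiplicity_eq_card_of_set`). In particular a
constituent with `π(f)|_{W₀} ≠ 0` for some `f` with `‖π(f)‖_{HS} < ∞` has finite multiplicity.
[cite: Gelbart1975, (10.12)–(10.14)] -/
theorem IsUnitary.multiplicity_mul_tsum_enorm_sq_le (hu : π.IsUnitary)
    (hc : π.IsStronglyContinuous) (η : Measure G) [IsFiniteMeasureOnCompacts η] (f : C_c(G, ℂ))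
    {S : Set (ClosedSubrep π)} (hirr : ∀ W ∈ S, W.toContRep.IsTopIrreducible)
    (horth : S.Pairwise fun W W' => W.toSubmodule ⟂ W'.toSubmodule)
    (hdense : ClosedSubrep.iSupClosure S = ⊤)
    {κ : S → Type*} (b : ∀ W : S, HilbertBasis (κ W) ℂ (W : ClosedSubrep π).toSubmodule)
    {ι₀ : Type*} (B₀ : HilbertBasis ι₀ ℂ H) (W₀ : S) :
    (π.multiplicity (W₀ : ClosedSubrep π).toContRep : ℝ≥0∞) *
        ∑' k, ‖π.integratedOperator hu hc η f (b W₀ k)‖ₑ ^ 2 ≤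
      ∑' l, ‖π.integratedOperator hu hc η f (B₀ l)‖ₑ ^ 2 := by
  rw [ClosedSubrep.tsum_enorm_sq_apply_eq_tsum_set horth hdense b B₀ (π.integratedOperator hu hc η f),
    hu.multiplicity_eq_card_of_set hirr horth hdense (W₀ : ClosedSubrep π).toContRep,
    ← ENNReal.tsum_const]
  calc ∑' W : {W : S // AreUnitarilyEquivalent (W : ClosedSubrep π).toContRep
          (W₀ : ClosedSubrep π).toContRep}, ∑' k, ‖π.integratedOperator hu hc η f (b W₀ k)‖ₑ ^ 2
        = ∑' W : {W : S // AreUnitarilyEquivalent (W : ClosedSubrep π).toContRep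
          (W₀ : ClosedSubrep π).toContRep}, ∑' k, ‖π.integratedOperator hu hc η f (b W.1 k)‖ₑ ^ 2 :=
          tsum_congr fun W =>
            ClosedSubrep.tsum_enorm_sq_integratedOperator_eq_of_areUnitarilyEquivalent hu hc η f W.2
              (b W.1) (b W₀)
    _ ≤ ∑' W : S, ∑' k, ‖π.integratedOperator hu hc η f (b W k)‖ₑ ^ 2 :=
          ENNReal.tsum_comp_le_tsum_of_injective Subtype.val_injective
            (fun W : S => ∑' k, ‖π.integratedOperator hu hc η f (b W k)‖ₑ ^ 2)

/-- **`m(V) · ‖π(f)|_V‖²_{HS} ≤ ‖π(f)‖²_{HS}` for every irreducible closed subrepresentation `V`**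
(not necessarily a member of the decomposition): `V` is unitarily equivalent to some `W₀ ∈ S`
(`IsUnitary.exists_mem_areUnitarilyEquivalent`), multiplicities and blocks agree along the
equivalence (`multiplicity_congr`, `tsum_enorm_sq_integratedOperator_eq_of_areUnitarilyEquivalent`),
and `multiplicity_mul_tsum_enorm_sq_le` applies. This is Gelbart's "`m(π') tr π'(f) π'(f)^*` is a
term of `tr R'_ψ(f ⋆ f^*)`" (1975, pp. 151–153). [cite: Gelbart1975, (10.12)–(10.14)] -/
theorem IsUnitary.multiplicity_mul_tsum_enorm_sq_le_of_isTopIrreducible (hu : π.IsUnitary)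
    (hc : π.IsStronglyContinuous) (η : Measure G) [IsFiniteMeasureOnCompacts η] (f : C_c(G, ℂ))
    {S : Set (ClosedSubrep π)} (hirr : ∀ W ∈ S, W.toContRep.IsTopIrreducible)
    (horth : S.Pairwise fun W W' => W.toSubmodule ⟂ W'.toSubmodule)
    (hdense : ClosedSubrep.iSupClosure S = ⊤)
    {ι₀ : Type*} (B₀ : HilbertBasis ι₀ ℂ H)
    {V : ClosedSubrep π} (hV : V.toContRep.IsTopIrreducible) {ι : Type*}
    (bV : HilbertBasis ι ℂ V.toSubmodule) :
    (π.multiplicity V.toContRep : ℝ≥0∞) * ∑' k, ‖π.integratedOperator hu hc η f (bV k)‖ₑ ^ 2 ≤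
      ∑' l, ‖π.integratedOperator hu hc η f (B₀ l)‖ₑ ^ 2 := by
  classical
  obtain ⟨W₀, hW₀S, hVW₀⟩ := hu.exists_mem_areUnitarilyEquivalent hirr hdense hV
  -- Hilbert bases of the members (any choice)
  have hb : ∀ W : S, ∃ (w : Set (W : ClosedSubrep π).toSubmodule)
      (b : HilbertBasis w ℂ (W : ClosedSubrep π).toSubmodule), ⇑b = ((↑) : w → _) :=
    fun W => exists_hilbertBasis ℂ _
  choose w b _hb using hb
  have h := hu.multiplicity_mul_tsum_enorm_sq_le hc η f hirr horth hdense b B₀ ⟨W₀, hW₀S⟩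
  rw [multiplicity_congr π hVW₀,
    ← ClosedSubrep.tsum_enorm_sq_integratedOperator_eq_of_areUnitarilyEquivalent hu hc η f hVW₀ bV
      (b ⟨W₀, hW₀S⟩)]
  exact h

/-! ### Regrouping the blocks by unitary equivalence classes: `Σ_σ m(σ) ‖σ(f)‖²_{HS}` -/

/-- **The blocks of one equivalence class add up to `m(W₀) · ‖π(f)|_{W₀}‖²_{HS}`**: for `W₀ ∈ S`,
`Σ_{W ∈ S, W ≃ W₀} Σ_k ‖π(f) e^W_k‖² = multiplicity π W₀ · Σ_k ‖π(f) e^{W₀}_k‖²` (the blocks are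
equal along the class, `tsum_enorm_sq_integratedOperator_eq_of_areUnitarilyEquivalent`, and the
class has `multiplicity π W₀` members, `IsUnitary.multiplicity_eq_card_of_set`; Mathlib
`ENNReal.tsum_const`). Gelbart (1975), p. 151 and (10.12): the term `m(π) tr π(f) π(f)^*`.
[cite: Gelbart1975, (10.12)–(10.14)] -/
theorem IsUnitary.tsum_subtype_areUnitarilyEquivalent_tsum_enorm_sq_eq (hu : π.IsUnitary)
    (hc : π.IsStronglyContinuous) (η : Measure G) [IsFiniteMeasureOnCompacts η] (f : C_c(G, ℂ))
    {S : Set (ClosedSubrep π)} (hirr : ∀ W ∈ S, W.toContRep.IsTopIrreducible)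
    (horth : S.Pairwise fun W W' => W.toSubmodule ⟂ W'.toSubmodule)
    (hdense : ClosedSubrep.iSupClosure S = ⊤)
    {κ : S → Type*} (b : ∀ W : S, HilbertBasis (κ W) ℂ (W : ClosedSubrep π).toSubmodule) (W₀ : S) :
    ∑' W : {W : S // AreUnitarilyEquivalent (W : ClosedSubrep π).toContRep
        (W₀ : ClosedSubrep π).toContRep}, ∑' k, ‖π.integratedOperator hu hc η f (b W.1 k)‖ₑ ^ 2 =
      (π.multiplicity (W₀ : ClosedSubrep π).toContRep : ℝ≥0∞) *
        ∑' k, ‖π.integratedOperator hu hc η f (b W₀ k)‖ₑ ^ 2 := by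
  rw [hu.multiplicity_eq_card_of_set hirr horth hdense (W₀ : ClosedSubrep π).toContRep,
    ← ENNReal.tsum_const]
  exact tsum_congr fun W =>
    (ClosedSubrep.tsum_enorm_sq_integratedOperator_eq_of_areUnitarilyEquivalent hu hc η f W.2
      (b W.1) (b W₀)).symm

omit [TopologicalSpace G] [MeasurableSpace G] [OpensMeasurableSpace G] in
/-- **Regrouping the Hilbert–Schmidt sum by the fibres of any class map** (pure reindexing,
Mathlib `ENNReal.tsum_fiberwise`): for every map `q : S → Λ`,
`Σ_l ‖T e_l‖² = Σ_{c : Λ} Σ_{W ∈ q⁻¹(c)} Σ_k ‖T e^W_k‖²`. With `q` classifying unitary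
equivalence (e.g. the quotient map) and the previous theorem, the right-hand side is Gelbart's
`Σ_σ m(σ) ‖σ(f)‖²_{HS}` (1975, (10.12)–(10.14)). [cite: Gelbart1975, (10.12)–(10.14)] -/
theorem ClosedSubrep.tsum_enorm_sq_apply_eq_tsum_fiberwise {S : Set (ClosedSubrep π)}
    (horth : S.Pairwise fun W W' => W.toSubmodule ⟂ W'.toSubmodule)
    (hdense : ClosedSubrep.iSupClosure S = ⊤)
    {κ : S → Type*} (b : ∀ W : S, HilbertBasis (κ W) ℂ (W : ClosedSubrep π).toSubmodule)
    {ι₀ : Type*} (B₀ : HilbertBasis ι₀ ℂ H)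
    {F : Type*} [NormedAddCommGroup F] [InnerProductSpace ℂ F] [CompleteSpace F] (T : H →L[ℂ] F)
    {Λ : Type*} (q : S → Λ) :
    ∑' l, ‖T (B₀ l)‖ₑ ^ 2 = ∑' c : Λ, ∑' W : q ⁻¹' {c}, ∑' k, ‖T (b W.1 k)‖ₑ ^ 2 := by
  rw [ClosedSubrep.tsum_enorm_sq_apply_eq_tsum_set horth hdense b B₀ T,
    ← ENNReal.tsum_fiberwise (fun W : S => ∑' k, ‖T (b W k)‖ₑ ^ 2) q]

/-- **The fibre of a map classifying unitary equivalence contributes `m(W₀) · ‖π(f)|_{W₀}‖²_{HS}`**: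
if `q W = q W' ↔ W ≃ W'` on `S`, then for `W₀ ∈ S`,
`Σ_{W ∈ q⁻¹(q W₀)} Σ_k ‖π(f) e^W_k‖² = multiplicity π W₀ · Σ_k ‖π(f) e^{W₀}_k‖²`; summed over the
classes (`tsum_enorm_sq_apply_eq_tsum_fiberwise`) this is the spectral side
`‖π(f)‖²_{HS} = Σ_σ m(σ) ‖σ(f)‖²_{HS}` of Gelbart (1975), (10.12)–(10.14).
[cite: Gelbart1975, (10.12)–(10.14)] -/
theorem IsUnitary.tsum_fiber_tsum_enorm_sq_eq (hu : π.IsUnitary)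
    (hc : π.IsStronglyContinuous) (η : Measure G) [IsFiniteMeasureOnCompacts η] (f : C_c(G, ℂ))
    {S : Set (ClosedSubrep π)} (hirr : ∀ W ∈ S, W.toContRep.IsTopIrreducible)
    (horth : S.Pairwise fun W W' => W.toSubmodule ⟂ W'.toSubmodule)
    (hdense : ClosedSubrep.iSupClosure S = ⊤)
    {κ : S → Type*} (b : ∀ W : S, HilbertBasis (κ W) ℂ (W : ClosedSubrep π).toSubmodule)
    {Λ : Type*} (q : S → Λ)
    (hq : ∀ W W' : S, q W = q W' ↔
      AreUnitarilyEquivalent (W : ClosedSubrep π).toContRep (W' : ClosedSubrep π).toContRep)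
    (W₀ : S) :
    ∑' W : q ⁻¹' {q W₀}, ∑' k, ‖π.integratedOperator hu hc η f (b W.1 k)‖ₑ ^ 2 =
      (π.multiplicity (W₀ : ClosedSubrep π).toContRep : ℝ≥0∞) *
        ∑' k, ‖π.integratedOperator hu hc η f (b W₀ k)‖ₑ ^ 2 := by
  have hset : q ⁻¹' {q W₀} = {W : S | AreUnitarilyEquivalent (W : ClosedSubrep π).toContRep
      (W₀ : ClosedSubrep π).toContRep} := by
    ext W
    rw [Set.mem_preimage, Set.mem_singleton_iff, Set.mem_setOf_eq]
    exact hq W W₀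
  rw [tsum_congr_set_coe (fun W : S => ∑' k, ‖π.integratedOperator hu hc η f (b W k)‖ₑ ^ 2) hset]
  exact hu.tsum_subtype_areUnitarilyEquivalent_tsum_enorm_sq_eq hc η f hirr horth hdense b W₀

end Integrated

end ContRepresentation
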